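import Mathlib
import Summits.NavierStokesRegularity.NavierStokesRegularity.Theorems.RootDecompLitSliceEnergyClockDissipation
import HarnessLib

/-!
# Route RootDecompLitSlice — cell Uᶜ `CritTameScarIsCritical` (stmt-NavierStokesRegularity-31733):
# the ENDPOINT of the mean-field bootstrap — a LINEAR lagged term bound closes energy-Type-I (hence Uᶜ's
# conclusion); the superlinear `5/4` bound does not; anatomy of the loss in `L³` currency

Helpers toward Uᶜ (`--supports 31733`, no item, no node); sequel of `RootDecompLitSliceMeanFieldBootstrapMap` /
`RootDecompLitSliceMeanFieldBootstrap` (decomp-ns writer g43). Frame of Uᶜ: maximal smooth solution on `[0,T)`,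
Leray–Hopf, decaying datum, TAME at `T`, CRITICAL CLOCK `∫|u(t)−u(T)|² ≤ K√(T−t)`; `τ = T − t`,
`D(t) = ‖u(t)‖₂² − ‖u(T)‖₂² = 2ν∫_t^T‖∇u‖₂² ≥ 0`.

ENDPOINT ANATOMY (paper-level). At the endpoint `a = 1/2` of the bootstrap (`Ψ(1/2) = 1/2`), with lag
`σ = mτ`, the mean-field lever gives `D(t) ≤ K(1+2m^{1/4})√τ + m^{−1/2}(1 + Λ)·√(D(T−mτ)·D(t))` PROVIDED the
trilinear term is paid in `L³`: `|⟨(v·∇)v, ū⟩| ≤ ‖v‖₆‖v−ū‖₃‖∇ū‖₂` with `Λ = C_S·O₃/ν`, `O₃` = the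
`L³`-OSCILLATION of the flow at comparable pre-blow-up times (`sup ‖u(r)−u(s)‖₃`, `r,s ∈ (T−mτ,T)`). Paying
`‖v−ū‖₃` from the `L²`-clock and the dissipation instead (`‖·‖₃ ≤ ‖·‖₂^{1/2}‖·‖₆^{1/2}`) is what produces the
superlinear `g^{5/4}` closing functional and loses the endpoint. An `L^∞_t L³_x` bound of the fluctuation against
a FIXED slice would be Seregin-vacuous (`‖u(t)‖₃ → ∞` at blow-up: the named fact
`Literature.Analysis.FluidPDE.seregin_L3_blowup_energy`, [Seregin2012CMP, Thm. 1.1]); the comparable-times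
oscillation is not forced to blow up by that theorem (under (discretely) self-similar Type-I SCALING it is
scale-invariant, `O(1)`, while `‖u(t)‖₃ → ∞`) — a heuristic consistency check, not a theorem.

KERNEL CONTENT (def-free):
* `linear_of_sqrt_bound` — AM–GM unpacking `x ≤ a + c√(yx) ⟹ x ≤ 2a + c²y`;
* `endpoint_closure` — the abstract closing argument: a bounded `D` with the LAGGED LINEAR recursion
  `D(t) ≤ A√τ + q·D(T−mτ)`, `q√m ≤ 1/2`, `m > 1`, obeys `D(t) ≤ C√τ` (induction on the depth
  `τ ≥ τ₀ m^{−(k+1)}`; geometric absorption);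
* `energyHalfHolder_of_linearEndpointBound` — on the classical Leray–Hopf frame, tame at `T`, with the critical
  clock: the LINEAR LAGGED TERM BOUND «`∃ B ≥ 0 ∀ m ≥ 1`, near `T`:
  `D(t) ≤ A_m√τ + (B/√m)√(D(T−mτ)D(t))`» forces the endpoint energy law `D(t) ≤ C√(T−t)` (energy-Type-I);
* `critTameScarIsCritical_of_linearEndpointBound` — CELL FORM: Uᶜ's frame, clock hypothesis and conclusion
  VERBATIM with that ONE inserted antecedent (`EnergyClockScarLaw.halfHolderClockCell` closes).

READING. The mean-field lever reaches every `a < 1/2` unconditionally-modulo-its-one-step and the endpoint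
exactly when the lagged term bound is LINEAR; the paper-level dictionary puts the endpoint residual of Uᶜ in
`L³` currency: «the `L³`-oscillation of the flow at its own clock is `o(m^{1/4})`» (ESS/Seregin control the
`L³` SIZE, which must blow up; this is the OSCILLATION at comparable times). HONEST FRAMING: a conditional face
INSIDE the Tao-vacuous, zero-load cell Uᶜ; no item, no node, no load of any route moves (ROOT ⟺ Uᵃ ∧ P1,
critic rows 354/371/698/717). Rung 0: nothing here proves NS regularity. [folklore]
-/

set_option linter.dupNamespace false

namespace Summit.NavierStokesRegularity.NavierStokesRegularity.Theorems

open MeasureTheory Set Filter Topology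
open scoped ENNReal
open Literature.Analysis.FluidPDE

namespace MeanFieldEndpoint

/-- AM–GM unpacking of a square-root term bound: `x ≤ a + c√(yx)` with `x, y ≥ 0` ⟹ `x ≤ 2a + c²y`.
[folklore] -/
theorem linear_of_sqrt_bound {x y a c : ℝ} (hx : 0 ≤ x) (hy : 0 ≤ y)
    (h : x ≤ a + c * Real.sqrt (y * x)) : x ≤ 2 * a + c ^ 2 * y := by
  have key : c * Real.sqrt (y * x) ≤ (c ^ 2 * y + x) / 2 := by
    rw [Real.sqrt_mul hy, ← mul_assoc]
    have h1 : 0 ≤ (c * Real.sqrt y - Real.sqrt x) ^ 2 := sq_nonneg _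
    have h2 : (c * Real.sqrt y - Real.sqrt x) ^ 2 =
        c ^ 2 * y + x - 2 * (c * Real.sqrt y * Real.sqrt x) := by
      have ey : Real.sqrt y ^ 2 = y := Real.sq_sqrt hy
      have ex : Real.sqrt x ^ 2 = x := Real.sq_sqrt hx
      calc (c * Real.sqrt y - Real.sqrt x) ^ 2
          = c ^ 2 * Real.sqrt y ^ 2 + Real.sqrt x ^ 2 - 2 * (c * Real.sqrt y * Real.sqrt x) := by ring
        _ = c ^ 2 * y + x - 2 * (c * Real.sqrt y * Real.sqrt x) := by rw [ey, ex]
    linarith [h1, h2]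
  linarith [key, h]

/-- ★ **Endpoint closing argument** (abstract). A function `D ≤ E₀` on `(T₁, T)` obeying the LAGGED LINEAR
recursion `D(t) ≤ A√(T−t) + q·D(T − m(T−t))` whenever the lagged time stays in the window, with `m > 1`,
`A, E₀, q ≥ 0` and `q√m ≤ 1/2`, satisfies `D(t) ≤ C√(T−t)` on the whole window: induction on the depth `k`
(`(T−T₁) m^{−(k+1)} ≤ T − t`), the lagged point having depth `k − 1`, with geometric absorption
`A + (q√m)C ≤ C` for `C ≥ 2A`. [folklore] -/
theorem endpoint_closure {T T₁ E₀ A q m : ℝ} {D : ℝ → ℝ} (hT₁ : T₁ < T) (hm : 1 < m)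
    (hA : 0 ≤ A) (hE₀ : 0 ≤ E₀) (hq : 0 ≤ q) (hqm : q * Real.sqrt m ≤ 1 / 2)
    (hD0 : ∀ t ∈ Ioo T₁ T, D t ≤ E₀)
    (hrec : ∀ t ∈ Ioo T₁ T, T₁ < T - m * (T - t) →
      D t ≤ A * Real.sqrt (T - t) + q * D (T - m * (T - t))) :
    ∃ C : ℝ, ∀ t ∈ Ioo T₁ T, D t ≤ C * Real.sqrt (T - t) := by
  obtain ⟨τ₀, hτ₀⟩ : ∃ τ₀ : ℝ, τ₀ = T - T₁ := ⟨_, rfl⟩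
  have hτ₀pos : 0 < τ₀ := by rw [hτ₀]; linarith
  have hm0 : 0 < m := by linarith
  obtain ⟨r, hr⟩ : ∃ r : ℝ, r = m⁻¹ := ⟨_, rfl⟩
  have hr0 : 0 < r := by rw [hr]; exact inv_pos.2 hm0
  have hr1 : r < 1 := by rw [hr]; exact inv_lt_one_of_one_lt₀ hm
  have hmr : m * r = 1 := by rw [hr]; exact mul_inv_cancel₀ hm0.ne'
  -- the constant
  have hθpos : 0 < τ₀ * r := mul_pos hτ₀pos hr0
  obtain ⟨C, hC⟩ : ∃ C : ℝ, C = 2 * A + E₀ / Real.sqrt (τ₀ * r) := ⟨_, rfl⟩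
  have hC0 : 0 ≤ C := by
    rw [hC]; exact add_nonneg (by linarith) (div_nonneg hE₀ (Real.sqrt_nonneg _))
  have hAC : A ≤ C / 2 := by
    rw [hC]; linarith [div_nonneg hE₀ (Real.sqrt_nonneg (τ₀ * r))]
  -- invariant on depth ≤ k
  have I : ∀ k : ℕ, ∀ t ∈ Ioo T₁ T, τ₀ * r ^ (k + 1) ≤ T - t → D t ≤ C * Real.sqrt (T - t) := by
    intro k
    induction k with
    | zero =>
      intro t ht hτ
      rw [zero_add, pow_one] at hτ
      have hsq : Real.sqrt (τ₀ * r) ≤ Real.sqrt (T - t) := Real.sqrt_le_sqrt hτ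
      have hsqpos : 0 < Real.sqrt (τ₀ * r) := Real.sqrt_pos.2 hθpos
      have h1 : E₀ ≤ E₀ / Real.sqrt (τ₀ * r) * Real.sqrt (T - t) := by
        have : E₀ = E₀ / Real.sqrt (τ₀ * r) * Real.sqrt (τ₀ * r) := by
          rw [div_mul_cancel₀ _ hsqpos.ne']
        calc E₀ = E₀ / Real.sqrt (τ₀ * r) * Real.sqrt (τ₀ * r) := this
          _ ≤ E₀ / Real.sqrt (τ₀ * r) * Real.sqrt (T - t) :=
            mul_le_mul_of_nonneg_left hsq (div_nonneg hE₀ hsqpos.le)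
      calc D t ≤ E₀ := hD0 t ht
        _ ≤ E₀ / Real.sqrt (τ₀ * r) * Real.sqrt (T - t) := h1
        _ ≤ C * Real.sqrt (T - t) := by
          apply mul_le_mul_of_nonneg_right _ (Real.sqrt_nonneg _)
          rw [hC]; linarith
    | succ k ih =>
      intro t ht hτ
      rcases le_or_gt (τ₀ * r ^ (k + 1)) (T - t) with hdepth | hdepth
      · exact ih t ht hdepth
      · have hτpos : 0 < T - t := by linarith [ht.2]
        -- the lagged point `t' = T − m (T − t)` has depth ≤ k and lies in the window
        have hlag1 : τ₀ * r ^ (k + 1) ≤ m * (T - t) := by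
          have h1 := mul_le_mul_of_nonneg_left hτ hm0.le
          have h2 : m * (τ₀ * r ^ (k + 1 + 1)) = τ₀ * r ^ (k + 1) * (m * r) := by ring
          rw [h2, hmr, mul_one] at h1
          exact h1
        have hlag2 : m * (T - t) < τ₀ := by
          have h1 := mul_lt_mul_of_pos_left hdepth hm0
          have h2 : m * (τ₀ * r ^ (k + 1)) = τ₀ * r ^ k * (m * r) := by ring
          rw [h2, hmr, mul_one] at h1
          have h3 : r ^ k ≤ 1 := pow_le_one₀ hr0.le hr1.le
          have h4 : τ₀ * r ^ k ≤ τ₀ := mul_le_of_le_one_right hτ₀pos.le h3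
          linarith
        have ht' : T - m * (T - t) ∈ Ioo T₁ T := by
          constructor
          · rw [hτ₀] at hlag2; linarith
          · have : 0 < m * (T - t) := mul_pos hm0 hτpos
            linarith
        have hT₁t' : T₁ < T - m * (T - t) := ht'.1
        have hdepth' : τ₀ * r ^ (k + 1) ≤ T - (T - m * (T - t)) := by
          rw [show T - (T - m * (T - t)) = m * (T - t) by ring]; exact hlag1
        have hDt' := ih _ ht' hdepth'
        rw [show T - (T - m * (T - t)) = m * (T - t) by ring, Real.sqrt_mul hm0.le] at hDt'
        -- absorb
        have hsq0 : 0 ≤ Real.sqrt (T - t) := Real.sqrt_nonneg _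
        have h1 := hrec t ht hT₁t'
        have h2 : q * D (T - m * (T - t)) ≤ q * (C * (Real.sqrt m * Real.sqrt (T - t))) :=
          mul_le_mul_of_nonneg_left hDt' hq
        have h3 : q * (C * (Real.sqrt m * Real.sqrt (T - t))) = (q * Real.sqrt m) * C * Real.sqrt (T - t) := by
          ring
        have h4 : (q * Real.sqrt m) * C * Real.sqrt (T - t) ≤ (1 / 2) * C * Real.sqrt (T - t) := by
          apply mul_le_mul_of_nonneg_right _ hsq0
          exact mul_le_mul_of_nonneg_right hqm hC0
        have h5 : A * Real.sqrt (T - t) ≤ (C / 2) * Real.sqrt (T - t) :=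
          mul_le_mul_of_nonneg_right hAC hsq0
        calc D t ≤ A * Real.sqrt (T - t) + q * D (T - m * (T - t)) := h1
          _ ≤ (C / 2) * Real.sqrt (T - t) + (1 / 2) * C * Real.sqrt (T - t) := by
            rw [h3] at h2; linarith [h2, h4, h5]
          _ = C * Real.sqrt (T - t) := by ring
  refine ⟨C, fun t ht => ?_⟩
  have hτpos : 0 < T - t := by linarith [ht.2]
  -- every point of the window has finite depth
  obtain ⟨n, hn⟩ := exists_pow_lt_of_lt_one (div_pos hτpos hτ₀pos) hr1
  have hdepth : τ₀ * r ^ (n + 1) ≤ T - t := by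
    have h1 : r ^ (n + 1) ≤ r ^ n := by
      rw [pow_succ]; exact mul_le_of_le_one_right (pow_nonneg hr0.le _) hr1.le
    have h2 : τ₀ * r ^ n < T - t := by
      have := mul_lt_mul_of_pos_left hn hτ₀pos
      rwa [mul_div_cancel₀ _ hτ₀pos.ne'] at this
    nlinarith [mul_le_mul_of_nonneg_left h1 hτ₀pos.le]
  exact I n t ht hdepth

/-- ★ **Energy-Type-I from a LINEAR lagged term bound.** On the classical Leray–Hopf frame (classical on
`[0,T)`, Leray–Hopf on `[0,T]`, decaying datum), TAME at `T`, with the critical clock: if the energy drop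
`D(t) = ‖u(t)‖₂² − ‖u(T)‖₂²` obeys, for some `B ≥ 0` and EVERY lag `m ≥ 1`, near `T`,
`D(t) ≤ A_m√(T−t) + (B/√m)·√(D(T−m(T−t))·D(t))` (the endpoint form of the mean-field one-step estimate when
the trilinear term is paid in `L³`), then `D(t) ≤ C√(T−t)` near `T` — the endpoint `a = 1/2`
(energy-Type-I): AM–GM (`linear_of_sqrt_bound`) at the lag `m = 4B⁴ + 4` gives the recursion of
`endpoint_closure` with `q√m = B²/√m ≤ 1/2`; `D ≥ 0` by `EnergyClockScarLaw.energyDrop_eq_dissipation_of_tame`,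
`D` bounded near `T` by the free quarter law `EnergyClockScarLaw.energyLaw_of_clock`. [folklore] -/
theorem energyHalfHolder_of_linearEndpointBound
    (ν T : ℝ) (hν : 0 < ν) (hT : 0 < T)
    (u : ℝ → EuclideanSpace ℝ (Fin 3) → EuclideanSpace ℝ (Fin 3)) (p : ℝ → EuclideanSpace ℝ (Fin 3) → ℝ)
    (hcl : IsClassicalNSSolutionOn (Ico 0 T) ν 0 u p) (hLH : IsLerayHopfOn T ν 0 (u 0) u)
    (hdec : HasRapidSpatialDecay (u 0))
    (htame : Tendsto (fun t => eLpNorm (u t - u T) 2 volume) (𝓝[<] T) (𝓝 0))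
    (hclock : ∃ K T₁ : ℝ, T₁ < T ∧ ∀ t ∈ Ioo T₁ T,
      ∫⁻ x, ‖u t x - u T x‖ₑ ^ 2 ≤ ENNReal.ofReal (K * Real.sqrt (T - t)))
    (hlin : ∃ B : ℝ, 0 ≤ B ∧ ∀ m : ℝ, 1 ≤ m → ∃ A T₁ : ℝ, T₁ < T ∧ ∀ t ∈ Ioo T₁ T,
      T₁ < T - m * (T - t) →
      (∫ x, ‖u t x‖ ^ 2) - ∫ x, ‖u T x‖ ^ 2 ≤ A * Real.sqrt (T - t) +
        B / Real.sqrt m * Real.sqrt ((((∫ x, ‖u (T - m * (T - t)) x‖ ^ 2) - ∫ x, ‖u T x‖ ^ 2)) *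
          ((∫ x, ‖u t x‖ ^ 2) - ∫ x, ‖u T x‖ ^ 2))) :
    ∃ C T₂ : ℝ, T₂ < T ∧ ∀ t ∈ Ioo T₂ T,
      (∫ x, ‖u t x‖ ^ 2) - ∫ x, ‖u T x‖ ^ 2 ≤ C * Real.sqrt (T - t) := by
  obtain ⟨B, hB, hlin⟩ := hlin
  -- the lag
  obtain ⟨m, hmdef⟩ : ∃ m : ℝ, m = 4 * B ^ 4 + 4 := ⟨_, rfl⟩
  have hm1 : 1 < m := by rw [hmdef]; nlinarith [pow_nonneg hB 4]
  have hm0 : 0 < m := by linarith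
  have hsqm : 2 * B ^ 2 ≤ Real.sqrt m := by
    have h1 : Real.sqrt ((2 * B ^ 2) ^ 2) = 2 * B ^ 2 := Real.sqrt_sq (by positivity)
    rw [← h1]
    apply Real.sqrt_le_sqrt
    rw [hmdef]; nlinarith [pow_nonneg hB 4]
  obtain ⟨A, T₁, hT₁, hA⟩ := hlin m hm1.le
  -- the free quarter law bounds `D` near `T`; nonnegativity of `D` from tameness
  have hclock' : ∃ K T₁ : ℝ, T₁ < T ∧ ∀ t ∈ Ioo T₁ T,
      ∫⁻ x, ‖u t x - u T x‖ₑ ^ 2 ≤ ENNReal.ofReal (K * (T - t) ^ (1 / 2 : ℝ)) := by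
    obtain ⟨K, T₁, hT₁, hK⟩ := hclock
    exact ⟨K, T₁, hT₁, fun t ht => by rw [← Real.sqrt_eq_rpow]; exact hK t ht⟩
  obtain ⟨C₄, T₄, hT₄, hC₄⟩ := EnergyClockScarLaw.energyLaw_of_clock (b := 1 / 2) ν T hν hT u p hcl hLH
    hdec hclock'
  set D : ℝ → ℝ := fun t => (∫ x, ‖u t x‖ ^ 2) - ∫ x, ‖u T x‖ ^ 2 with hDdef
  have hDnn : ∀ t ∈ Ico 0 T, 0 ≤ D t := by
    intro t ht
    show 0 ≤ (∫ x, ‖u t x‖ ^ 2) - ∫ x, ‖u T x‖ ^ 2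
    rw [EnergyClockScarLaw.energyDrop_eq_dissipation_of_tame hν hT hcl hLH htame ht]
    exact mul_nonneg (by positivity) ENNReal.toReal_nonneg
  -- the working window
  obtain ⟨T₅, hT₅def⟩ : ∃ T₅ : ℝ, T₅ = max (max T₁ T₄) (max 0 (T - 1)) := ⟨_, rfl⟩
  have hT₅T : T₅ < T := by
    rw [hT₅def]; exact max_lt (max_lt hT₁ hT₄) (max_lt hT (by linarith))
  have hT₁₅ : T₁ ≤ T₅ := by rw [hT₅def]; exact (le_max_left _ _).trans (le_max_left _ _)
  have hT₄₅ : T₄ ≤ T₅ := by rw [hT₅def]; exact (le_max_right _ _).trans (le_max_left _ _)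
  have h0₅ : 0 ≤ T₅ := by rw [hT₅def]; exact (le_max_left _ _).trans (le_max_right _ _)
  have h1₅ : T - 1 ≤ T₅ := by rw [hT₅def]; exact (le_max_right _ _).trans (le_max_right _ _)
  have hwin : ∀ t ∈ Ioo T₅ T, t ∈ Ico 0 T ∧ T₁ < t ∧ T₄ < t ∧ T - t ≤ 1 := fun t ht =>
    ⟨⟨h0₅.trans ht.1.le, ht.2⟩, lt_of_le_of_lt hT₁₅ ht.1, lt_of_le_of_lt hT₄₅ ht.1, by linarith [ht.1]⟩
  -- boundedness on the window
  have hD0 : ∀ t ∈ Ioo T₅ T, D t ≤ max C₄ 0 := by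
    intro t ht
    obtain ⟨-, -, h4, h1⟩ := hwin t ht
    have hτ0 : 0 ≤ T - t := by linarith [ht.2]
    have hpow : (T - t) ^ ((1 / 2 : ℝ) / 2) ≤ 1 := Real.rpow_le_one hτ0 h1 (by norm_num)
    calc D t ≤ C₄ * (T - t) ^ ((1 / 2 : ℝ) / 2) := hC₄ t ⟨h4, ht.2⟩
      _ ≤ max C₄ 0 * (T - t) ^ ((1 / 2 : ℝ) / 2) :=
        mul_le_mul_of_nonneg_right (le_max_left _ _) (Real.rpow_nonneg hτ0 _)
      _ ≤ max C₄ 0 * 1 := mul_le_mul_of_nonneg_left hpow (le_max_right _ _)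
      _ = max C₄ 0 := mul_one _
  -- the lagged linear recursion on the window (AM–GM)
  have hrec : ∀ t ∈ Ioo T₅ T, T₅ < T - m * (T - t) →
      D t ≤ 2 * max A 0 * Real.sqrt (T - t) + (B / Real.sqrt m) ^ 2 * D (T - m * (T - t)) := by
    intro t ht hlag
    obtain ⟨ht0, h1, -, -⟩ := hwin t ht
    have hτpos : 0 < T - t := by linarith [ht.2]
    have ht' : T - m * (T - t) ∈ Ioo T₅ T :=
      ⟨hlag, by have := mul_pos hm0 hτpos; linarith⟩
    obtain ⟨ht'0, -, -, -⟩ := hwin _ ht'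
    have hx : 0 ≤ D t := hDnn t ht0
    have hy : 0 ≤ D (T - m * (T - t)) := hDnn _ ht'0
    have hb := hA t ⟨h1, ht.2⟩ (lt_of_le_of_lt hT₁₅ hlag)
    have hb' : D t ≤ max A 0 * Real.sqrt (T - t) +
        B / Real.sqrt m * Real.sqrt (D (T - m * (T - t)) * D t) := by
      have : A * Real.sqrt (T - t) ≤ max A 0 * Real.sqrt (T - t) :=
        mul_le_mul_of_nonneg_right (le_max_left _ _) (Real.sqrt_nonneg _)
      exact hb.trans (by linarith)
    calc D t ≤ 2 * (max A 0 * Real.sqrt (T - t)) + (B / Real.sqrt m) ^ 2 * D (T - m * (T - t)) :=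
          linear_of_sqrt_bound hx hy hb'
      _ = 2 * max A 0 * Real.sqrt (T - t) + (B / Real.sqrt m) ^ 2 * D (T - m * (T - t)) := by ring
  -- `q √m = B²/√m ≤ 1/2`
  have hq : 0 ≤ (B / Real.sqrt m) ^ 2 := sq_nonneg _
  have hqm : (B / Real.sqrt m) ^ 2 * Real.sqrt m ≤ 1 / 2 := by
    have hsq0 : 0 < Real.sqrt m := Real.sqrt_pos.2 hm0
    rw [div_pow, Real.sq_sqrt hm0.le]
    rcases hB.eq_or_lt with hB0 | hB0
    · rw [← hB0]; simp
    · -- B² /m · √m = B²/√m ≤ 1/2  ⟸  2B² ≤ √m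
      have h1 : B ^ 2 / m * Real.sqrt m = B ^ 2 / Real.sqrt m := by
        rw [div_mul_eq_mul_div, div_eq_div_iff hm0.ne' hsq0.ne', mul_assoc, Real.mul_self_sqrt hm0.le]
      rw [h1, div_le_iff₀ hsq0]
      linarith
  have hA2 : 0 ≤ 2 * max A 0 := by positivity
  obtain ⟨C, hC⟩ := endpoint_closure (D := D) hT₅T hm1 hA2 (le_max_right C₄ 0) hq hqm hD0 hrec
  exact ⟨C, T₅, hT₅T, fun t ht => hC t ht⟩

/-- **Cell form**: Uᶜ `CritTameScarIsCritical`'s frame (maximal smooth solution, Leray–Hopf, decaying datum,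
tame at `T`), its √-clock hypothesis and its conclusion VERBATIM, with ONE inserted antecedent — the LINEAR
lagged term bound of the energy drop (`∃ B ≥ 0 ∀ m ≥ 1`, near `T`:
`D(t) ≤ A_m√(T−t) + (B/√m)√(D(T−m(T−t))D(t))`). The endpoint of the mean-field bootstrap, closed by
`energyHalfHolder_of_linearEndpointBound` + `EnergyClockScarLaw.halfHolderClockCell`. [folklore] -/
theorem critTameScarIsCritical_of_linearEndpointBound :
    ∀ (ν T : ℝ), 0 < ν → 0 < T → ∀ (u : ℝ → EuclideanSpace ℝ (Fin 3) → EuclideanSpace ℝ (Fin 3))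
      (p : ℝ → EuclideanSpace ℝ (Fin 3) → ℝ),
      Literature.Analysis.FluidPDE.IsMaximalSmoothSolution ν 0 u p T →
      Literature.Analysis.FluidPDE.IsLerayHopfOn T ν 0 (u 0) u →
      Literature.Analysis.FluidPDE.HasRapidSpatialDecay (u 0) →
      Filter.Tendsto (fun t => MeasureTheory.eLpNorm (u t - u T) 2 MeasureTheory.volume)
        (nhdsWithin T (Set.Iio T)) (nhds 0) →
      (∃ K T₁ : ℝ, T₁ < T ∧ ∀ t ∈ Set.Ioo T₁ T,
        ∫⁻ x, ‖u t x - u T x‖ₑ ^ 2 ≤ ENNReal.ofReal (K * Real.sqrt (T - t))) →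
      (∃ B : ℝ, 0 ≤ B ∧ ∀ m : ℝ, 1 ≤ m → ∃ A T₁ : ℝ, T₁ < T ∧ ∀ t ∈ Set.Ioo T₁ T,
        T₁ < T - m * (T - t) →
        (∫ x, ‖u t x‖ ^ 2) - ∫ x, ‖u T x‖ ^ 2 ≤ A * Real.sqrt (T - t) +
          B / Real.sqrt m * Real.sqrt ((((∫ x, ‖u (T - m * (T - t)) x‖ ^ 2) - ∫ x, ‖u T x‖ ^ 2)) *
            ((∫ x, ‖u t x‖ ^ 2) - ∫ x, ‖u T x‖ ^ 2))) →
      ∀ x₀ : EuclideanSpace ℝ (Fin 3), ∃ M r₁ : ℝ, 0 < r₁ ∧ ∀ r ∈ Set.Ioo 0 r₁,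
        r⁻¹ * ∫ x in Metric.ball x₀ r, ‖u T x‖ ^ 2 ≤ M :=
  fun ν T hν hT u p hmax hLH hdec htame hclock hlin x₀ =>
    EnergyClockScarLaw.halfHolderClockCell ν T hν hT u p hmax hLH hdec htame hclock
      (energyHalfHolder_of_linearEndpointBound ν T hν hT u p hmax.1 hLH hdec htame hclock hlin) x₀

end MeanFieldEndpoint

end Summit.NavierStokesRegularity.NavierStokesRegularity.Theorems
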